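import Summits.ABC.ABC.Theorems.LogCardinalitySubPowerStewartYuFamily
import Literature.NumberTheory.DiophantineGeometry.PastenSubexpTheorem14
import HarnessLib

/-!
# Sub-power Stewart–Yu (crux `SubPowerStewartYu`, stmt-ABC-11053), III: Yu's bound on the inflated family

`Summits/ABC/ABC/Theorems/LogCardinalitySubPowerStewartYuInflation.lean` — third helper file toward
`Summit.ABC.ABC.Theses.LogCardinality.SubPowerStewartYu`.

The crux inlines Yu's 2013 `p`-adic bound over `ℚ` (Stewart 2013, Lemma 5 with `d = f = 1`,
`δ ≥ 1`, constants weakened to `Aⁿ`) as the hypothesis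

  `hYu A : ∀ n p α b, 1 ≤ n → p prime → 5 ≤ p → (αᵢ ≠ 0 p-adic units) → (mult. independent) → b ≠ 0 →
     ord_p(∏ αᵢ^{bᵢ} − 1) ≤ Aⁿ · max(p (n/log p)ⁿ, eⁿ log p) · ∏ max(1, h(αᵢ)) · max(log(2 + ∑|bᵢ|), n²)`

[cite: Stewart2013, Lemma 5 (arXiv:1008.1274 p. 8)] [cite: Yu2013, Main Theorem]. Here:

* `hypYu_fintype`: the same over an arbitrary finite index type, with `A` replaced by
  `Ā = max(|A|, 1)` and the `max` by a sum (a weakening valid for every real `A`);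
* `inflated_bound`: the hypothesis applied to the inflated family of
  `LogCardinalitySubPowerStewartYuFamily` — for coprime positive `u, v`, a prime `p ∤ uv`, `p ≥ 5`,
  `q₁ ∣ uv` and auxiliary primes `P` (not dividing `p·u·v`, `log r ≤ m`):
  `ord_p((u/v)² − 1) ≤ Ā^{n'} (p (n'/log p)^{n'} + e^{n'} log p) · 2^{ω(uv)} (∏_{q∣uv} log q) (3 + 2|P|m) m^{|P|}
     · max(log(2 + 2(|P|+1) ∑_{q∣uv} ν_q(uv)), n'²)`, `n' = ω(uv) + |P|`
  — Stewart's (31)–(33) for `a + b = c` [cite: Stewart2013, proof of Lemma 8 (arXiv pp. 9–10)];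
* `factorization_le_padicValRat_sq_sub_one_c` / `_a`: for an abc triple, `ν_p(c) ≤ ord_p((a/b)² − 1)`
  (`p ∣ c`) and `ν_p(a) ≤ ord_p((b/c)² − 1)` (`p ∣ a`) — the square removes the sign of `∓u/v`.
No new definitions.
-/

noncomputable section

-- `Summit.ABC.ABC.…` is the tree's namespace convention for this sub-problem (summit = problem).
set_option linter.dupNamespace false

open Finset Real Height
open Literature.NumberTheory.DiophantineGeometry
open Literature.NumberTheory.DiophantineGeometry.Dioph
open Literature.NumberTheory.DiophantineGeometry.Pasten

namespace Summit.ABC.ABC.Theorems.SubPowerSY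

/-! ### Yu's bound over an arbitrary finite index type -/

/-- **The inlined Yu bound, transported to any finite index type**, with `A` replaced by
`Ā = max(|A|, 1)` and `max(X, Y)` by `X + Y` (both weakenings: `Aⁿ ≤ Āⁿ`, the other factors are
non-negative). [cite: Stewart2013, Lemma 5 (arXiv p. 8)] -/
theorem hypYu_fintype {A : ℝ}
    (hYu : ∀ (n p : ℕ) (α : Fin n → ℚ) (b : Fin n → ℤ), 1 ≤ n → p.Prime → 5 ≤ p →
      (∀ i, α i ≠ 0 ∧ padicValRat p (α i) = 0) → (∀ e : Fin n → ℤ, ∏ i, α i ^ e i = 1 → e = 0) →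
      b ≠ 0 → (padicValRat p (∏ i, α i ^ b i - 1) : ℝ) ≤
        A ^ n * max ((p : ℝ) * ((n : ℝ) / Real.log p) ^ n) (Real.exp n * Real.log p) *
          (∏ i, max 1 (logHeight₁ (α i))) * max (Real.log (2 + ∑ i, |(b i : ℝ)|)) ((n : ℝ) ^ 2))
    (ι : Type) [Fintype ι] (hι : 0 < Fintype.card ι) {p : ℕ} (hp : p.Prime) (hp5 : 5 ≤ p)
    (α : ι → ℚ) (hα : ∀ i, α i ≠ 0 ∧ padicValRat p (α i) = 0)
    (hind : ∀ e : ι → ℤ, ∏ i, α i ^ e i = 1 → e = 0) (b : ι → ℤ) (hb : b ≠ 0) :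
    (padicValRat p (∏ i, α i ^ b i - 1) : ℝ) ≤
      max |A| 1 ^ Fintype.card ι *
        ((p : ℝ) * ((Fintype.card ι : ℝ) / Real.log p) ^ Fintype.card ι +
          Real.exp (Fintype.card ι) * Real.log p) *
        (∏ i, max 1 (logHeight₁ (α i))) *
        max (Real.log (2 + ∑ i, |(b i : ℝ)|)) ((Fintype.card ι : ℝ) ^ 2) := by
  classical
  set n := Fintype.card ι with hn
  obtain ⟨e⟩ : Nonempty (ι ≃ Fin n) := ⟨Fintype.equivFin ι⟩
  -- transport the data to `Fin n`
  have hα' : ∀ i : Fin n, α (e.symm i) ≠ 0 ∧ padicValRat p (α (e.symm i)) = 0 := fun i => hα _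
  have hind' : ∀ c : Fin n → ℤ, ∏ i, α (e.symm i) ^ c i = 1 → c = 0 := by
    intro c hc
    have hc' : ∏ j : ι, α j ^ c (e j) = 1 := by
      rw [← hc]
      exact Fintype.prod_equiv e _ _ fun j => by rw [Equiv.symm_apply_apply]
    have h0 := hind (fun j => c (e j)) hc'
    funext i
    have hi := congrFun h0 (e.symm i)
    simpa using hi
  have hb' : (fun i : Fin n => b (e.symm i)) ≠ 0 := by
    intro h
    apply hb
    funext j
    have := congrFun h (e j)
    simpa using this
  have hV := hYu n p (fun i => α (e.symm i)) (fun i => b (e.symm i)) hι hp hp5 hα' hind' hb'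
  have hprod : ∏ i : Fin n, α (e.symm i) ^ b (e.symm i) = ∏ j : ι, α j ^ b j :=
    Fintype.prod_equiv e.symm _ _ fun i => rfl
  have hheight : ∏ i : Fin n, max 1 (logHeight₁ (α (e.symm i))) = ∏ j : ι, max 1 (logHeight₁ (α j)) :=
    Fintype.prod_equiv e.symm _ _ fun i => rfl
  have hsum : ∑ i : Fin n, |((b (e.symm i) : ℤ) : ℝ)| = ∑ j : ι, |((b j : ℤ) : ℝ)| :=
    Fintype.sum_equiv e.symm _ _ fun i => rfl
  rw [hprod, hheight, hsum] at hV
  -- weaken `A^n ≤ Ā^n` and `max ≤ sum`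
  have hp0 : (0 : ℝ) < p := by exact_mod_cast hp.pos
  have hlogp : 0 < Real.log p := Real.log_pos (by exact_mod_cast hp.one_lt)
  have hT1 : 0 ≤ (p : ℝ) * ((n : ℝ) / Real.log p) ^ n := by positivity
  have hT2 : 0 ≤ Real.exp n * Real.log p := by positivity
  have hmax : max ((p : ℝ) * ((n : ℝ) / Real.log p) ^ n) (Real.exp n * Real.log p) ≤
      (p : ℝ) * ((n : ℝ) / Real.log p) ^ n + Real.exp n * Real.log p :=
    max_le (by linarith) (by linarith)
  have hmax0 : 0 ≤ max ((p : ℝ) * ((n : ℝ) / Real.log p) ^ n) (Real.exp n * Real.log p) :=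
    le_trans hT1 (le_max_left _ _)
  have hH : 0 ≤ ∏ j : ι, max 1 (logHeight₁ (α j)) :=
    Finset.prod_nonneg fun j _ => le_trans zero_le_one (le_max_left _ _)
  have hM : 0 ≤ max (Real.log (2 + ∑ j : ι, |((b j : ℤ) : ℝ)|)) ((n : ℝ) ^ 2) :=
    le_trans (sq_nonneg _) (le_max_right _ _)
  have hA : A ^ n ≤ max |A| 1 ^ n := by
    calc A ^ n ≤ |A ^ n| := le_abs_self _
      _ = |A| ^ n := abs_pow A n
      _ ≤ max |A| 1 ^ n := pow_le_pow_left₀ (abs_nonneg A) (le_max_left _ _) n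
  have hA0 : 0 ≤ max |A| 1 ^ n := pow_nonneg (le_trans zero_le_one (le_max_right _ _)) n
  calc (padicValRat p (∏ j, α j ^ b j - 1) : ℝ) ≤ _ := hV
    _ ≤ max |A| 1 ^ n * ((p : ℝ) * ((n : ℝ) / Real.log p) ^ n + Real.exp n * Real.log p) *
        (∏ j : ι, max 1 (logHeight₁ (α j))) *
        max (Real.log (2 + ∑ j : ι, |((b j : ℤ) : ℝ)|)) ((n : ℝ) ^ 2) := by
        apply mul_le_mul_of_nonneg_right _ hM
        apply mul_le_mul_of_nonneg_right _ hH
        exact mul_le_mul hA hmax hmax0 hA0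

/-! ### The valuation at a prime of a member is that of `(u/v)² − 1` -/

section Triple

variable {a b c : ℕ}

/-- For an abc triple with `ab > 1` and a prime `p ∣ c`: `ν_p(c) ≤ ord_p((a/b)² − 1)`
(`(a/b)² − 1 = (a − b) c / b²`, `p ∤ b`, `a ≠ b`). [folklore] -/
theorem factorization_le_padicValRat_sq_sub_one_c (h : IsABCTriple a b c) (h1 : 1 < a * b)
    {p : ℕ} (hp : p ∈ c.primeFactors) :
    (c.factorization p : ℝ) ≤ (padicValRat p ((((a : ℚ) / b) ^ 2) - 1) : ℝ) := by
  obtain ⟨ha, hb, habc, hcop⟩ := id h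
  have hp' := Nat.prime_of_mem_primeFactors hp
  have hpc := Nat.dvd_of_mem_primeFactors hp
  haveI := Fact.mk hp'
  have hc : 0 < c := by omega
  have hbc : b.Coprime c := coprime_right_of_isABCTriple h
  have hpb : ¬ p ∣ b := fun hpb =>
    hp'.one_lt.ne' (Nat.dvd_one.mp (hbc.gcd_eq_one ▸ Nat.dvd_gcd hpb hpc))
  have hab : a ≠ b := by
    rintro rfl
    have : a = 1 := by simpa [Nat.coprime_self] using hcop
    subst this; omega
  have hb' : (b : ℚ) ≠ 0 := by exact_mod_cast hb.ne'
  have hd : ((a : ℤ) - b : ℤ) ≠ 0 := by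
    intro h0; apply hab; exact_mod_cast (sub_eq_zero.mp h0)
  have hrew : (((a : ℚ) / b) ^ 2) - 1 = ((((a : ℤ) - b : ℤ)) : ℚ) * (c : ℚ) / (b : ℚ) ^ 2 := by
    rw [div_pow, div_sub_one (pow_ne_zero 2 hb'), eq_div_iff (pow_ne_zero 2 hb'),
      div_mul_cancel₀ _ (pow_ne_zero 2 hb')]
    push_cast
    rw [show (c : ℚ) = a + b by exact_mod_cast habc.symm]
    ring
  have key : (c.factorization p : ℤ) ≤ padicValRat p ((((a : ℚ) / b) ^ 2) - 1) := by
    rw [hrew, padicValRat.div (mul_ne_zero (by exact_mod_cast hd) (by exact_mod_cast hc.ne'))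
      (pow_ne_zero 2 hb'), padicValRat.mul (by exact_mod_cast hd) (by exact_mod_cast hc.ne'),
      padicValRat.pow, padicValRat.of_nat, padicValRat.of_nat,
      padicValNat.eq_zero_of_not_dvd hpb, padicValRat.of_int, Nat.factorization_def c hp']
    have : (0 : ℤ) ≤ (padicValInt p ((a : ℤ) - b) : ℤ) := by exact_mod_cast Nat.zero_le _
    push_cast
    linarith
  exact_mod_cast key

/-- For an abc triple and a prime `p ∣ a`: `ν_p(a) ≤ ord_p((b/c)² − 1)`
(`(b/c)² − 1 = −a (b + c) / c²`, `p ∤ c`). [folklore] -/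
theorem factorization_le_padicValRat_sq_sub_one_a (h : IsABCTriple a b c)
    {p : ℕ} (hp : p ∈ a.primeFactors) :
    (a.factorization p : ℝ) ≤ (padicValRat p ((((b : ℚ) / c) ^ 2) - 1) : ℝ) := by
  obtain ⟨ha, hb, habc, hcop⟩ := id h
  have hp' := Nat.prime_of_mem_primeFactors hp
  have hpa := Nat.dvd_of_mem_primeFactors hp
  haveI := Fact.mk hp'
  have hc : 0 < c := by omega
  have hac : a.Coprime c := coprime_left_of_isABCTriple h
  have hpc : ¬ p ∣ c := fun hpc =>
    hp'.one_lt.ne' (Nat.dvd_one.mp (hac.gcd_eq_one ▸ Nat.dvd_gcd hpa hpc))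
  have hc' : (c : ℚ) ≠ 0 := by exact_mod_cast hc.ne'
  have hcq : (c : ℚ) = a + b := by exact_mod_cast habc.symm
  have hbc_cast : ((b : ℚ) + c) = ((b + c : ℕ) : ℚ) := by push_cast; ring
  have hbc0 : ((b : ℚ) + c) ≠ 0 := by
    rw [hbc_cast]; exact_mod_cast (show b + c ≠ 0 by omega)
  have hrew : (((b : ℚ) / c) ^ 2) - 1 = -(((a : ℚ) * ((b : ℚ) + c)) / (c : ℚ) ^ 2) := by
    field_simp
    rw [hcq]; ring
  have key : (a.factorization p : ℤ) ≤ padicValRat p ((((b : ℚ) / c) ^ 2) - 1) := by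
    rw [hrew, padicValRat.neg, padicValRat.div (mul_ne_zero (by exact_mod_cast ha.ne') hbc0)
      (pow_ne_zero 2 hc'), padicValRat.mul (by exact_mod_cast ha.ne') hbc0,
      padicValRat.pow, padicValRat.of_nat, padicValRat.of_nat,
      padicValNat.eq_zero_of_not_dvd hpc, Nat.factorization_def a hp']
    have : (0 : ℤ) ≤ padicValRat p ((b : ℚ) + c) := by
      rw [hbc_cast, padicValRat.of_nat]; exact_mod_cast Nat.zero_le _
    push_cast
    linarith
  exact_mod_cast key

end Triple

/-! ### Yu's bound on the inflated family -/

section Inflation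

variable {A : ℝ} {u v q₁ p : ℕ} {P : Finset ℕ}

/-- **Stewart's inflation for `a + b = c` (raw form).** For coprime positive `u, v`, a prime
`p ≥ 5` with `p ∤ uv`, a prime `q₁ ∣ uv`, and a finite set `P` of auxiliary primes with
`r ∤ uv`, `r ≠ p`, `log r ≤ m` (`m ≥ 1`) for `r ∈ P`, the inlined Yu bound applied to the inflated
family gives, with `n' = ω(uv) + |P|` and `Ā = max(|A|, 1)`,
`ord_p((u/v)² − 1) ≤ Ā^{n'} (p (n'/log p)^{n'} + e^{n'} log p) ·
  (2^{ω(uv)} (∏_{q ∣ uv} log q) (3 + 2|P| m) m^{|P|}) · max(log(2 + 2(|P|+1) ∑_{q ∣ uv} ν_q(uv)), n'²)`.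
[cite: Stewart2013, proof of Lemma 8, (31)–(33) (arXiv pp. 9–10)] -/
theorem inflated_bound
    (hYu : ∀ (n p : ℕ) (α : Fin n → ℚ) (b : Fin n → ℤ), 1 ≤ n → p.Prime → 5 ≤ p →
      (∀ i, α i ≠ 0 ∧ padicValRat p (α i) = 0) → (∀ e : Fin n → ℤ, ∏ i, α i ^ e i = 1 → e = 0) →
      b ≠ 0 → (padicValRat p (∏ i, α i ^ b i - 1) : ℝ) ≤
        A ^ n * max ((p : ℝ) * ((n : ℝ) / Real.log p) ^ n) (Real.exp n * Real.log p) *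
          (∏ i, max 1 (logHeight₁ (α i))) * max (Real.log (2 + ∑ i, |(b i : ℝ)|)) ((n : ℝ) ^ 2))
    (hu : 0 < u) (hv : 0 < v) (huv : u.Coprime v) (hq₁ : q₁ ∈ (u * v).primeFactors)
    (hp : p.Prime) (hp5 : 5 ≤ p) (hpuv : ¬ p ∣ u * v)
    (hP : ∀ r ∈ P, r.Prime ∧ ¬ r ∣ u * v ∧ r ≠ p) {m : ℝ} (hm : 1 ≤ m)
    (hPm : ∀ r ∈ P, Real.log r ≤ m) :
    (padicValRat p ((((u : ℚ) / v) ^ 2) - 1) : ℝ) ≤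
      max |A| 1 ^ ((u * v).primeFactors.card + P.card) *
        ((p : ℝ) * ((((u * v).primeFactors.card + P.card : ℕ) : ℝ) / Real.log p) ^
            ((u * v).primeFactors.card + P.card) +
          Real.exp (((u * v).primeFactors.card + P.card : ℕ) : ℝ) * Real.log p) *
        (2 ^ (u * v).primeFactors.card * (∏ q ∈ (u * v).primeFactors, Real.log q) *
          (3 + 2 * P.card * m) * m ^ P.card) *
        max (Real.log (2 + 2 * (P.card + 1) * ∑ q ∈ (u * v).primeFactors, ((u * v).factorization q : ℝ)))
          ((((u * v).primeFactors.card + P.card : ℕ) : ℝ) ^ 2) := by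
  classical
  set ι := ↥((u * v).primeFactors.erase q₁) ⊕ Option ↥P
  set α : ι → ℚ := Sum.elim (fun q : ↥((u * v).primeFactors.erase q₁) => ((q : ℕ) : ℚ))
    (auxFamily q₁ 1 P) with hα
  set β : ι → ℤ := Sum.elim (fun q : ↥((u * v).primeFactors.erase q₁) => 2 * expDiff u v q)
    (fun _ => 2 * expDiff u v q₁) with hβ
  have hq₁p : q₁.Prime := Nat.prime_of_mem_primeFactors hq₁
  have hS : ∀ q ∈ (u * v).primeFactors.erase q₁, q.Prime := fun q hq =>
    Nat.prime_of_mem_primeFactors (Finset.mem_of_mem_erase hq)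
  have hPp : ∀ r ∈ P, r.Prime := fun r hr => (hP r hr).1
  have hcard : Fintype.card ι = (u * v).primeFactors.card + P.card := card_family hq₁
  have hι : 0 < Fintype.card ι := by
    rw [hcard]; have := Finset.card_pos.mpr ⟨q₁, hq₁⟩; omega
  have hαu : ∀ i, α i ≠ 0 ∧ padicValRat p (α i) = 0 := fun i =>
    ⟨family_ne_zero hq₁p.pos hS hPp i,
      padicValRat_family hp hpuv hq₁ (fun r hr => ⟨(hP r hr).1, (hP r hr).2.2⟩) i⟩
  have hind : ∀ e : ι → ℤ, ∏ i, α i ^ e i = 1 → e = 0 :=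
    family_multIndep hq₁ (fun r hr => ⟨(hP r hr).1, (hP r hr).2.1⟩)
  have hβ0 : β ≠ 0 := family_exp_ne_zero hu.ne' hv.ne' huv hq₁
  have hV := hypYu_fintype hYu ι hι hp hp5 α hαu hind β hβ0
  rw [show ∏ i, α i ^ β i = ((u : ℚ) / v) ^ 2 from prod_family_zpow hu.ne' hv.ne' huv hq₁ hPp,
    hcard] at hV
  -- bound the height factor and the exponent factor
  have hH := prod_max_one_logHeight₁_family_le (u := u) (v := v) hq₁ hPp hm hPm
  have hE := sum_abs_family_exp_le (P := P) hu.ne' hv.ne' huv hq₁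
  set n' := (u * v).primeFactors.card + P.card with hn'
  have hp0 : (0 : ℝ) < p := by exact_mod_cast hp.pos
  have hlogp : 0 < Real.log p := Real.log_pos (by exact_mod_cast hp.one_lt)
  have hA0 : 0 ≤ max |A| 1 ^ n' := pow_nonneg (le_trans zero_le_one (le_max_right _ _)) _
  have hT0 : 0 ≤ (p : ℝ) * (((n' : ℕ) : ℝ) / Real.log p) ^ n' + Real.exp ((n' : ℕ) : ℝ) * Real.log p := by
    positivity
  have hH0 : 0 ≤ ∏ i, max 1 (logHeight₁ (α i)) :=
    Finset.prod_nonneg fun i _ => le_trans zero_le_one (le_max_left _ _)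
  have hsum0 : 0 ≤ ∑ i, |((β i : ℤ) : ℝ)| := Finset.sum_nonneg fun i _ => abs_nonneg _
  have hM : max (Real.log (2 + ∑ i, |((β i : ℤ) : ℝ)|)) (((n' : ℕ) : ℝ) ^ 2) ≤
      max (Real.log (2 + 2 * (P.card + 1) * ∑ q ∈ (u * v).primeFactors, ((u * v).factorization q : ℝ)))
        (((n' : ℕ) : ℝ) ^ 2) := by
    refine max_le_max ?_ le_rfl
    refine Real.log_le_log (by linarith) ?_
    have := hE
    linarith
  have hM0' : 0 ≤ max (Real.log (2 + 2 * (P.card + 1) *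
      ∑ q ∈ (u * v).primeFactors, ((u * v).factorization q : ℝ))) (((n' : ℕ) : ℝ) ^ 2) :=
    le_trans (sq_nonneg _) (le_max_right _ _)
  calc (padicValRat p ((((u : ℚ) / v) ^ 2) - 1) : ℝ) ≤ _ := hV
    _ ≤ max |A| 1 ^ n' *
        ((p : ℝ) * (((n' : ℕ) : ℝ) / Real.log p) ^ n' + Real.exp ((n' : ℕ) : ℝ) * Real.log p) *
        (2 ^ (u * v).primeFactors.card * (∏ q ∈ (u * v).primeFactors, Real.log q) *
          (3 + 2 * P.card * m) * m ^ P.card) *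
        max (Real.log (2 + 2 * (P.card + 1) * ∑ q ∈ (u * v).primeFactors, ((u * v).factorization q : ℝ)))
          (((n' : ℕ) : ℝ) ^ 2) := by
        apply mul_le_mul _ hM (le_trans (sq_nonneg _) (le_max_right _ _)) (by positivity)
        exact mul_le_mul_of_nonneg_left hH (mul_nonneg hA0 hT0)

end Inflation

end Summit.ABC.ABC.Theorems.SubPowerSY

end
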